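import Mathlib
import Summits.AtomisticToContinuum.HydrodynamicLimit.Theorems.ImplosionDichotomyDenseExcursionR2SelfSimilar

/-!
# Radial reduction of the self-similar hard-sphere Euler system — stub `stub_radialReduction` (W4)

Crux `Summit.AtomisticToContinuum.HydrodynamicLimit.Theses.ImplosionDichotomy.DenseExcursion`
(stmt-AtomisticToContinuum-12586), line `r2-one-mode-two-conditions`, stub `stub_radialReduction` (W4).

**Mathematics.** Off the centre (`ζ ≠ 0`) write `q = ‖ζ‖`, `p = logPt (τ, ζ) = (τ, log q)`, `' = ∂ₓ`. The
radial point map has `D(logPt)(τ, ζ)(a, η) = (a, ⟪ζ, η⟫/q²)` (`hasFDerivAt_logPt`), whence for a scalar `f`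
differentiable at `p`: `∂_τ(f ∘ logPt) = f_τ(p)`, `∂ᵢ(f ∘ logPt) = f'(p) ζᵢ/q²` (`fderiv_comp_logPt_time /
space`), so `Σᵢ ζᵢ ∂ᵢ(f ∘ logPt) = f'`, `∂ᵢ‖ζ‖² = 2ζᵢ`, `∇·ζ = 3`. For the radial fields
`𝒫 = pf ∘ logPt`, `𝒱 = -(w ∘ logPt) ζ`, `Θ̂ = q² (tf ∘ logPt)`:
* mass residual `= pf_τ + (1-w)pf' - pf w' + 3(1-w)pf + (3r-6)pf = pf_τ - ((w-1)pf' + pf(w' + 3w + 3 - 3r))`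
  (`rad_mass`);
* `j`-th momentum residual `= ζⱼ (pf(-w_τ - (r-1)w - (1-w)(w' + w)) + 2Π + Π')` with the pressure
  `Π = pf tf Z(pf D³)`, `Π' = pf' tf Z + pf tf' Z + pf tf Z' pf' D³`, i.e. `-(ζⱼ pf)(w_τ - rhs_w)` (`rad_momentum`;
  this is the one place where the diameter `D` must be differentiable at `τ`, for the pressure to be Fréchet
  differentiable at `z`);
* temperature residual minus heating `= q² (tf_τ + 2(r-1)tf + (1-w)(2tf + tf') - (2/3) tf Z (3w + w') - H(Z-1)tf)
  = q² (tf_τ - rhs_tf)` (`rad_temperature`).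
Hence the equivalence `radialReduction_of_differentiableAt` (mass: `sub_eq_zero`; momentum: if the common factor
`w_τ - rhs_w` were nonzero every `ζⱼ` would vanish, contradicting `ζ ≠ 0`; temperature: divide by `q² ≠ 0`).
In the final algebra `‖ζ‖²` is written `ζ₀² + ζ₁² + ζ₂²` and the identities close by `field_simp; ring`.
Every lemma below is folklore calculus (template: the landed `Theorems.KidderKnobMelnikov.dual_*` and
`R2OneModeTwoConditions.ss_*` identities).

**On the registered signature.** `RadialReduction` (defs module `…R2SelfSimilar`) quantifies over an ARBITRARY
`D : ℝ → ℝ`; without `DifferentiableAt ℝ D z.1` it is false (for a `D` discontinuous at `τ` the pressure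
`w ↦ 𝒫 Θ̂ Z(𝒫 D(w.1)³)` is not differentiable at `z`, its `fderiv` is `0`, and the self-similar momentum equation
degenerates while the reduced `w`-equation keeps the pressure terms). The theorem proved here is the registered
statement with that one hypothesis added, in the registered binder order
`r D H Z pf w tf z, hz hpf hw htf hpos hD hZ`; once the defs module inserts `DifferentiableAt ℝ D z.1 →` before the
`Z`-hypothesis, `stub_radialReduction : RadialReduction := radialReduction_of_differentiableAt`.
-/

noncomputable section

open Filter Set
open scoped Topology ContDiff RealInnerProductSpace

namespace Summit.AtomisticToContinuum.HydrodynamicLimit.Theorems.R2OneModeTwoConditions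

open Literature.MathematicalPhysics.KineticTheory (V3)

open Summit.AtomisticToContinuum.HydrodynamicLimit.Theorems.KidderKnobMelnikov

/-! ## Calculus of the radial point map `logPt` -/

section LogPtCalculus

variable {G : Type*} [NormedAddCommGroup G] [NormedSpace ℝ G] {z : ℝ × V3}

/-- `D(‖ζ‖²)(τ, ζ)(a, η) = 2⟪ζ, η⟫` on `ℝ × ℝ³`. [folklore] -/
theorem hasFDerivAt_normSq_snd (z : ℝ × V3) :
    HasFDerivAt (fun w : ℝ × V3 => ‖w.2‖ ^ 2)
      ((2 : ℝ) • (innerSL ℝ z.2).comp (ContinuousLinearMap.snd ℝ ℝ V3)) z := by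
  have h := (hasStrictFDerivAt_norm_sq z.2).hasFDerivAt.comp z hasFDerivAt_snd
  refine h.congr_fderiv (ContinuousLinearMap.ext fun v => ?_)
  simp [two_smul]

/-- `D(log ‖ζ‖)(τ, ζ)(a, η) = ⟪ζ, η⟫ / ‖ζ‖²` off the centre. [folklore] -/
theorem hasFDerivAt_log_norm_snd (hz : z.2 ≠ 0) :
    HasFDerivAt (fun w : ℝ × V3 => Real.log ‖w.2‖)
      ((‖z.2‖ ^ 2)⁻¹ • (innerSL ℝ z.2).comp (ContinuousLinearMap.snd ℝ ℝ V3)) z := by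
  have hq : ‖z.2‖ ^ 2 ≠ 0 := pow_ne_zero 2 (norm_ne_zero_iff.mpr hz)
  have h := ((hasFDerivAt_normSq_snd z).log hq).const_mul (2⁻¹ : ℝ)
  have heq : (fun w : ℝ × V3 => 2⁻¹ * Real.log (‖w.2‖ ^ 2)) = fun w => Real.log ‖w.2‖ := by
    funext w
    rw [Real.log_pow]
    push_cast
    ring
  rw [heq] at h
  refine h.congr_fderiv (ContinuousLinearMap.ext fun v => ?_)
  simp only [smul_apply, smul_eq_mul]
  ring

/-- The Fréchet derivative of `logPt`: `D(logPt)(τ, ζ)(a, η) = (a, ⟪ζ, η⟫ / ‖ζ‖²)`. [folklore] -/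
theorem hasFDerivAt_logPt (hz : z.2 ≠ 0) :
    HasFDerivAt logPt
      ((ContinuousLinearMap.fst ℝ ℝ V3).prod
        ((‖z.2‖ ^ 2)⁻¹ • (innerSL ℝ z.2).comp (ContinuousLinearMap.snd ℝ ℝ V3))) z :=
  hasFDerivAt_fst.prodMk (hasFDerivAt_log_norm_snd hz)

/-- Chain rule through `logPt`. [folklore] -/
theorem hasFDerivAt_comp_logPt {F : ℝ × ℝ → G} (hz : z.2 ≠ 0) (hF : DifferentiableAt ℝ F (logPt z)) :
    HasFDerivAt (fun w => F (logPt w))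
      ((fderiv ℝ F (logPt z)).comp ((ContinuousLinearMap.fst ℝ ℝ V3).prod
        ((‖z.2‖ ^ 2)⁻¹ • (innerSL ℝ z.2).comp (ContinuousLinearMap.snd ℝ ℝ V3)))) z :=
  hF.hasFDerivAt.comp z (hasFDerivAt_logPt hz)

/-- `L (0, c) = c • L (0, 1)` for a continuous linear map on `ℝ × ℝ`. [folklore] -/
theorem clm_apply_zero_mk (L : ℝ × ℝ →L[ℝ] G) (c : ℝ) : L (0, c) = c • L (0, 1) := by
  rw [← map_smul]
  exact congrArg L (Prod.ext (by simp) (by simp))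

/-- Time derivative through `logPt`: `∂_τ (F ∘ logPt) = (∂_τ F) ∘ logPt` off the centre. [folklore] -/
theorem fderiv_comp_logPt_time {F : ℝ × ℝ → G} (hz : z.2 ≠ 0) (hF : DifferentiableAt ℝ F (logPt z)) :
    fderiv ℝ (fun w => F (logPt w)) z (1, 0) = fderiv ℝ F (logPt z) (1, 0) := by
  rw [(hasFDerivAt_comp_logPt hz hF).fderiv]
  simp

/-- Space derivatives through `logPt`: `∂ᵢ (F ∘ logPt)(τ, ζ) = (ζᵢ / ‖ζ‖²) (∂ₓ F)(logPt (τ, ζ))` off the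
centre. [folklore] -/
theorem fderiv_comp_logPt_space {F : ℝ × ℝ → G} (hz : z.2 ≠ 0) (hF : DifferentiableAt ℝ F (logPt z))
    (i : Fin 3) :
    fderiv ℝ (fun w => F (logPt w)) z (0, EuclideanSpace.single i 1) =
      ((‖z.2‖ ^ 2)⁻¹ * z.2 i) • fderiv ℝ F (logPt z) (0, 1) := by
  rw [(hasFDerivAt_comp_logPt hz hF).fderiv]
  simp only [ContinuousLinearMap.coe_comp, Function.comp_apply, ContinuousLinearMap.prod_apply,
    ContinuousLinearMap.coe_fst', smul_apply, ContinuousLinearMap.coe_snd', innerSL_apply_apply,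
    EuclideanSpace.inner_single_right, conj_trivial, one_mul, smul_eq_mul]
  rw [clm_apply_zero_mk]

end LogPtCalculus

/-! ## The radial fields -/

section Fields

/-- `radDensity pf = pf ∘ logPt`. [folklore] -/
theorem radDensity_eq (pf : ℝ × ℝ → ℝ) : radDensity pf = fun y => pf (logPt y) := rfl

/-- `radTemperature tf = ‖ζ‖² · (tf ∘ logPt)`. [folklore] -/
theorem radTemperature_eq (tf : ℝ × ℝ → ℝ) :
    radTemperature tf = fun y => ‖y.2‖ ^ 2 * tf (logPt y) := rfl

/-- The radial velocity, componentwise: `𝒱ⱼ(τ, ζ) = -w(τ, log ‖ζ‖) ζⱼ`. [folklore] -/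
theorem radVelocity_apply (w : ℝ × ℝ → ℝ) (y : ℝ × V3) (j : Fin 3) :
    radVelocity w y j = -w (logPt y) * y.2 j := by
  simp only [radVelocity, PiLp.smul_apply, smul_eq_mul]

/-- `‖ζ‖² = ζ₀² + ζ₁² + ζ₂²` for the spatial component of a space-time point of `ℝ × ℝ³` (stated on `ℝ × V3`
on purpose: the plain `V3` form already exists elsewhere in the tree under another namespace). [folklore] -/
theorem norm_snd_sq_eq_three (z : ℝ × V3) : ‖z.2‖ ^ 2 = z.2 0 ^ 2 + z.2 1 ^ 2 + z.2 2 ^ 2 := by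
  rw [EuclideanSpace.norm_sq_eq, Fin.sum_univ_three]
  simp only [Real.norm_eq_abs, sq_abs]

/-- Off the centre, `ζ₀² + ζ₁² + ζ₂² ≠ 0`. [folklore] -/
theorem coord_sq_sum_ne_zero {z : ℝ × V3} (hz : z.2 ≠ 0) : z.2 0 ^ 2 + z.2 1 ^ 2 + z.2 2 ^ 2 ≠ 0 := by
  rw [← norm_snd_sq_eq_three]
  exact pow_ne_zero 2 (norm_ne_zero_iff.mpr hz)

end Fields

/-! ## The three residual identities -/

section Identities

variable {z : ℝ × V3} {pf w tf : ℝ × ℝ → ℝ}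

/-- **Mass.** For the radial fields the self-similar mass residual
`∂_τ𝒫 + ∇·(𝒫(𝒱 + ζ)) + (3r-6)𝒫` equals `pf_τ - ((w-1)pf' + pf(w' + 3w + 3 - 3r))` at `logPt z`
(`Σᵢ ζᵢ ∂ᵢ(f ∘ logPt) = f'`, `∇·ζ = 3`). [folklore] -/
theorem rad_mass (hz : z.2 ≠ 0) (hpf : DifferentiableAt ℝ pf (logPt z))
    (hw : DifferentiableAt ℝ w (logPt z)) (r : ℝ) :
    dT (radDensity pf) z + ∑ i, dX i (fun y => radDensity pf y * (radVelocity w y i + y.2 i)) z +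
        (3 * r - 6) * radDensity pf z =
      dτ pf (logPt z) - ((w (logPt z) - 1) * dx pf (logPt z) +
          pf (logPt z) * (dx w (logPt z) + 3 * w (logPt z) + 3 - 3 * r)) := by
  have hP : HasFDerivAt (fun y => pf (logPt y)) (fderiv ℝ (fun y => pf (logPt y)) z) z :=
    (hasFDerivAt_comp_logPt hz hpf).differentiableAt.hasFDerivAt
  have hW : HasFDerivAt (fun y => w (logPt y)) (fderiv ℝ (fun y => w (logPt y)) z) z :=
    (hasFDerivAt_comp_logPt hz hw).differentiableAt.hasFDerivAt
  have hDV := fun i =>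
    (hP.fun_mul ((hW.fun_neg.fun_mul (hasFDerivAt_coord z i)).fun_add (hasFDerivAt_coord z i))).fderiv
  unfold dT dX dτ dx
  simp only [radDensity_eq, radVelocity_apply]
  simp only [hDV]
  simp only [add_apply, smul_apply, neg_apply, ContinuousLinearMap.coe_comp, Function.comp_apply,
    ContinuousLinearMap.coe_snd', PiLp.proj_apply,
    fderiv_comp_logPt_time hz hpf, fderiv_comp_logPt_space hz hpf, fderiv_comp_logPt_space hz hw,
    smul_eq_mul]
  simp only [Fin.sum_univ_three, PiLp.single_apply, norm_snd_sq_eq_three]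
  have h0 := coord_sq_sum_ne_zero hz
  generalize fderiv ℝ pf (logPt z) (1, 0) = A
  generalize fderiv ℝ pf (logPt z) (0, 1) = B
  generalize fderiv ℝ w (logPt z) (0, 1) = C
  norm_num
  field_simp
  ring

/-- **Momentum** (`j`-th component). For the radial fields, with `Z` differentiable at the packing and the
diameter `D` differentiable at `τ`, the self-similar momentum residual is
`-(ζⱼ pf) · (w_τ - ((w-1)w' + w² - rw + (2tf + tf pf'/pf + tf')Z + tf Z' pf' D³))` at `logPt z`: every term is
a multiple of `ζⱼ` (`∂ⱼ(‖ζ‖² Π∘logPt) = (2Π + Π')ζⱼ` for the pressure `Π = pf tf Z(pf D³)`). [folklore] -/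
theorem rad_momentum (hz : z.2 ≠ 0) (hpf : DifferentiableAt ℝ pf (logPt z))
    (hw : DifferentiableAt ℝ w (logPt z)) (htf : DifferentiableAt ℝ tf (logPt z))
    (hpos : pf (logPt z) ≠ 0) {D : ℝ → ℝ} (hD : DifferentiableAt ℝ D z.1) {Z : ℝ → ℝ}
    (hZ : DifferentiableAt ℝ Z (pf (logPt z) * D z.1 ^ 3)) (r : ℝ) (j : Fin 3) :
    radDensity pf z * (dT (fun y => radVelocity w y j) z + (r - 1) * radVelocity w z j +
          ∑ i, (z.2 i + radVelocity w z i) * dX i (fun y => radVelocity w y j) z) +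
        dX j (fun y => radDensity pf y * radTemperature tf y * Z (radDensity pf y * D y.1 ^ 3)) z =
      -(z.2 j * pf (logPt z)) * (dτ w (logPt z) -
        ((w (logPt z) - 1) * dx w (logPt z) + w (logPt z) ^ 2 - r * w (logPt z) +
          (2 * tf (logPt z) + tf (logPt z) * dx pf (logPt z) / pf (logPt z) + dx tf (logPt z)) *
              Z (pf (logPt z) * D z.1 ^ 3) +
            tf (logPt z) * deriv Z (pf (logPt z) * D z.1 ^ 3) * (dx pf (logPt z) * D z.1 ^ 3))) := by
  have hP : HasFDerivAt (fun y => pf (logPt y)) (fderiv ℝ (fun y => pf (logPt y)) z) z :=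
    (hasFDerivAt_comp_logPt hz hpf).differentiableAt.hasFDerivAt
  have hW : HasFDerivAt (fun y => w (logPt y)) (fderiv ℝ (fun y => w (logPt y)) z) z :=
    (hasFDerivAt_comp_logPt hz hw).differentiableAt.hasFDerivAt
  have hT : HasFDerivAt (fun y => tf (logPt y)) (fderiv ℝ (fun y => tf (logPt y)) z) z :=
    (hasFDerivAt_comp_logPt hz htf).differentiableAt.hasFDerivAt
  have hD3 : HasFDerivAt (fun y : ℝ × V3 => D y.1 ^ 3)
      ((↑(3 : ℕ) * D z.1 ^ (3 - 1) * deriv D z.1) • ContinuousLinearMap.fst ℝ ℝ V3) z :=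
    (hD.hasDerivAt.fun_pow 3).comp_hasFDerivAt z hasFDerivAt_fst
  have hZc : HasFDerivAt (fun y => Z (pf (logPt y) * D y.1 ^ 3)) _ z :=
    hZ.hasDerivAt.comp_hasFDerivAt z (hP.fun_mul hD3)
  have hPr : HasFDerivAt
      (fun y => pf (logPt y) * (‖y.2‖ ^ 2 * tf (logPt y)) * Z (pf (logPt y) * D y.1 ^ 3)) _ z :=
    (hP.fun_mul ((hasFDerivAt_normSq_snd z).fun_mul hT)).fun_mul hZc
  have hVd := fun j => (hW.fun_neg.fun_mul (hasFDerivAt_coord z j)).fderiv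
  unfold dT dX dτ dx
  simp only [radDensity_eq, radTemperature_eq, radVelocity_apply]
  simp only [hVd, hPr.fderiv]
  simp only [add_apply, smul_apply, neg_apply, ContinuousLinearMap.coe_comp, Function.comp_apply,
    ContinuousLinearMap.coe_fst', ContinuousLinearMap.coe_snd', PiLp.proj_apply, innerSL_apply_apply,
    EuclideanSpace.inner_single_right, conj_trivial, one_mul,
    fderiv_comp_logPt_time hz hw, fderiv_comp_logPt_space hz hpf, fderiv_comp_logPt_space hz hw,
    fderiv_comp_logPt_space hz htf, smul_eq_mul, mul_zero, zero_add]
  simp only [PiLp.single_apply, mul_ite, mul_one, mul_zero, mul_add, add_mul, Finset.sum_add_distrib,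
    Finset.sum_ite_eq, Finset.mem_univ, if_true]
  simp only [Fin.sum_univ_three, norm_snd_sq_eq_three]
  have h0 := coord_sq_sum_ne_zero hz
  generalize fderiv ℝ w (logPt z) (1, 0) = Wt
  generalize fderiv ℝ w (logPt z) (0, 1) = Wx
  generalize fderiv ℝ pf (logPt z) (0, 1) = Px
  generalize fderiv ℝ tf (logPt z) (0, 1) = Tx
  generalize deriv Z (pf (logPt z) * D z.1 ^ 3) = Zd
  generalize Z (pf (logPt z) * D z.1 ^ 3) = Zc
  norm_num
  field_simp
  ring

/-- **Temperature.** For the radial fields the self-similar temperature residual (left side minus the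
heating `H Θ̂ (Z-1)`) is `‖ζ‖² · (tf_τ - ((w-1)tf' + (2/3) Z tf w' + tf(2w - 2r + 2wZ) + H(Z-1)tf))` at
`logPt z` (`∂_τ(‖ζ‖² tf∘logPt) = ‖ζ‖² tf_τ`, `(ζ·∇)(‖ζ‖² tf∘logPt) = ‖ζ‖²(2tf + tf')`,
`∇·𝒱 = -(3w + w')`). [folklore] -/
theorem rad_temperature (hz : z.2 ≠ 0) (hw : DifferentiableAt ℝ w (logPt z))
    (htf : DifferentiableAt ℝ tf (logPt z)) (r : ℝ) (D H Z : ℝ → ℝ) :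
    dT (radTemperature tf) z + 2 * (r - 1) * radTemperature tf z +
            ∑ i, (z.2 i + radVelocity w z i) * dX i (radTemperature tf) z +
          2 / 3 * radTemperature tf z * Z (radDensity pf z * D z.1 ^ 3) *
            ∑ i, dX i (fun y => radVelocity w y i) z -
        H z.1 * radTemperature tf z * (Z (radDensity pf z * D z.1 ^ 3) - 1) =
      ‖z.2‖ ^ 2 * (dτ tf (logPt z) -
        ((w (logPt z) - 1) * dx tf (logPt z) +
          2 / 3 * Z (pf (logPt z) * D z.1 ^ 3) * tf (logPt z) * dx w (logPt z) +
          tf (logPt z) * (2 * w (logPt z) - 2 * r + 2 * w (logPt z) * Z (pf (logPt z) * D z.1 ^ 3)) +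
          H z.1 * (Z (pf (logPt z) * D z.1 ^ 3) - 1) * tf (logPt z))) := by
  have hW : HasFDerivAt (fun y => w (logPt y)) (fderiv ℝ (fun y => w (logPt y)) z) z :=
    (hasFDerivAt_comp_logPt hz hw).differentiableAt.hasFDerivAt
  have hT : HasFDerivAt (fun y => tf (logPt y)) (fderiv ℝ (fun y => tf (logPt y)) z) z :=
    (hasFDerivAt_comp_logPt hz htf).differentiableAt.hasFDerivAt
  have hTh : HasFDerivAt (fun y : ℝ × V3 => ‖y.2‖ ^ 2 * tf (logPt y)) _ z :=
    (hasFDerivAt_normSq_snd z).fun_mul hT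
  have hVd := fun j => (hW.fun_neg.fun_mul (hasFDerivAt_coord z j)).fderiv
  unfold dT dX dτ dx
  simp only [radDensity_eq, radTemperature_eq, radVelocity_apply]
  simp only [hVd, hTh.fderiv]
  simp only [add_apply, smul_apply, neg_apply, ContinuousLinearMap.coe_comp, Function.comp_apply,
    ContinuousLinearMap.coe_snd', PiLp.proj_apply, innerSL_apply_apply,
    inner_zero_right, EuclideanSpace.inner_single_right, conj_trivial, one_mul,
    fderiv_comp_logPt_time hz htf, fderiv_comp_logPt_space hz hw,
    fderiv_comp_logPt_space hz htf, smul_eq_mul, mul_zero, add_zero]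
  simp only [Fin.sum_univ_three, PiLp.single_apply, norm_snd_sq_eq_three]
  have h0 := coord_sq_sum_ne_zero hz
  generalize fderiv ℝ tf (logPt z) (1, 0) = Tt
  generalize fderiv ℝ w (logPt z) (0, 1) = Wx
  generalize fderiv ℝ tf (logPt z) (0, 1) = Tx
  generalize Z (pf (logPt z) * D z.1 ^ 3) = Zc
  norm_num
  field_simp
  ring

end Identities

/-! ## The reduction -/

/-- **Radial reduction of the self-similar system, off the centre** (the content of the registered stub
`stub_radialReduction`, with the diameter `D` assumed differentiable at `τ`): for radial fields built from
`(pf, w, tf)(τ, x)` differentiable at `p = (τ, log ‖ζ‖)`, `ζ ≠ 0`, `pf(p) > 0`, `D` differentiable at `τ` and `Z`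
differentiable at the packing `pf(p) D(τ)³`, the self-similar Euler system `SelfSimEulerZAt r D H Z` holds at
`(τ, ζ)` iff the three scalar equations of `RadialReduction` hold at `p`. Mass: the residual IS `pf_τ - rhs`;
momentum: the `j`-th residual is `-(ζⱼ pf)(w_τ - rhs)` and some `ζⱼ ≠ 0`; temperature: the residual is
`‖ζ‖² (tf_τ - rhs)`. [folklore] -/
theorem radialReduction_of_differentiableAt (r : ℝ) (D H Z : ℝ → ℝ) (pf w tf : ℝ × ℝ → ℝ) (z : ℝ × V3)
    (hz : z.2 ≠ 0) (hpf : DifferentiableAt ℝ pf (logPt z)) (hw : DifferentiableAt ℝ w (logPt z))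
    (htf : DifferentiableAt ℝ tf (logPt z)) (hpos : 0 < pf (logPt z)) (hD : DifferentiableAt ℝ D z.1)
    (hZ : DifferentiableAt ℝ Z (pf (logPt z) * D z.1 ^ 3)) :
    SelfSimEulerZAt r D H Z (radDensity pf) (radTemperature tf) (radVelocity w) z ↔
      (dτ pf (logPt z) = (w (logPt z) - 1) * dx pf (logPt z) +
          pf (logPt z) * (dx w (logPt z) + 3 * w (logPt z) + 3 - 3 * r) ∧
       dτ w (logPt z) = (w (logPt z) - 1) * dx w (logPt z) + w (logPt z) ^ 2 - r * w (logPt z) +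
          (2 * tf (logPt z) + tf (logPt z) * dx pf (logPt z) / pf (logPt z) + dx tf (logPt z)) *
              Z (pf (logPt z) * D z.1 ^ 3) +
            tf (logPt z) * deriv Z (pf (logPt z) * D z.1 ^ 3) * (dx pf (logPt z) * D z.1 ^ 3) ∧
       dτ tf (logPt z) = (w (logPt z) - 1) * dx tf (logPt z) +
          2 / 3 * Z (pf (logPt z) * D z.1 ^ 3) * tf (logPt z) * dx w (logPt z) +
          tf (logPt z) * (2 * w (logPt z) - 2 * r + 2 * w (logPt z) * Z (pf (logPt z) * D z.1 ^ 3)) +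
          H z.1 * (Z (pf (logPt z) * D z.1 ^ 3) - 1) * tf (logPt z)) := by
  have hq : ‖z.2‖ ^ 2 ≠ 0 := pow_ne_zero 2 (norm_ne_zero_iff.mpr hz)
  unfold SelfSimEulerZAt
  refine and_congr ?_ (and_congr ?_ ?_)
  · rw [rad_mass hz hpf hw r, sub_eq_zero]
  · constructor
    · intro h
      by_contra hX
      apply hq
      have hj : ∀ j, z.2 j = 0 := fun j => by
        have := h j
        rw [rad_momentum hz hpf hw htf hpos.ne' hD hZ r j, mul_eq_zero, neg_eq_zero, mul_eq_zero,
          sub_eq_zero] at this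
        rcases this with (h1 | h1) | h1
        · exact h1
        · exact absurd h1 hpos.ne'
        · exact absurd h1 hX
      rw [norm_snd_sq_eq_three, hj 0, hj 1, hj 2]
      norm_num
    · intro h j
      rw [rad_momentum hz hpf hw htf hpos.ne' hD hZ r j, h, sub_self, mul_zero]
  · exact (eq_iff_of_sub_eq_mul_sub (rad_temperature hz hw htf r D H Z) hq).symm


/-- **STUB W4 of the line `r2-one-mode-two-conditions` (`stub_radialReduction`, registered RESHAPED signature), PROVED**:
the radial reduction of the self-similar hard-sphere system with a general equation of state, off the centre, under
differentiability of the fields at `(τ, log ‖ζ‖)`, of the diameter `D` at `τ` and of `Z` at the packing — the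
hypothesis `DifferentiableAt ℝ D z.1` being exactly what the original line-posited `RadialReduction` missed
(without it `fderiv` junk makes the equivalence fail; kernel-checked counterexample by the worker). [folklore] -/
theorem stub_radialReduction : ∀ (r : ℝ) (D H Z : ℝ → ℝ) (pf w tf : ℝ × ℝ → ℝ) (z : ℝ × V3), z.2 ≠ 0 → DifferentiableAt ℝ pf (logPt z) → DifferentiableAt ℝ w (logPt z) → DifferentiableAt ℝ tf (logPt z) → 0 < pf (logPt z) → DifferentiableAt ℝ D z.1 → DifferentiableAt ℝ Z (pf (logPt z) * D z.1 ^ 3) → (SelfSimEulerZAt r D H Z (radDensity pf) (radTemperature tf) (radVelocity w) z ↔ (dτ pf (logPt z) = (w (logPt z) - 1) * dx pf (logPt z) + pf (logPt z) * (dx w (logPt z) + 3 * w (logPt z) + 3 - 3 * r) ∧ dτ w (logPt z) = (w (logPt z) - 1) * dx w (logPt z) + w (logPt z) ^ 2 - r * w (logPt z) + (2 * tf (logPt z) + tf (logPt z) * dx pf (logPt z) / pf (logPt z) + dx tf (logPt z)) * Z (pf (logPt z) * D z.1 ^ 3) + tf (logPt z) * deriv Z (pf (logPt z) * D z.1 ^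 3) * (dx pf (logPt z) * D z.1 ^ 3) ∧ dτ tf (logPt z) = (w (logPt z) - 1) * dx tf (logPt z) + 2 / 3 * Z (pf (logPt z) * D z.1 ^ 3) * tf (logPt z) * dx w (logPt z) + tf (logPt z) * (2 * w (logPt z) - 2 * r + 2 * w (logPt z) * Z (pf (logPt z) * D z.1 ^ 3)) + H z.1 * (Z (pf (logPt z) * D z.1 ^ 3) - 1) * tf (logPt z))) :=
  fun r D H Z pf w tf z hz hpf hw htf hpos hD hZ =>
    radialReduction_of_differentiableAt r D H Z pf w tf z hz hpf hw htf hpos hD hZ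

end Summit.AtomisticToContinuum.HydrodynamicLimit.Theorems.R2OneModeTwoConditions

end
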